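import Summits.QuantumFields.BalabanUV.T4Continuum.Support.VariationalCovariantPoincare
import Summits.QuantumFields.BalabanUV.T4Continuum.Support.VariationalCovariantFederbush

/-!
# T⁴ programme, spine node NE2 (U1a), lane P2 — leaf REG⁺ of the variational route, file 1/2: THE COVARIANT LAPLACIAN `D_R†D_R`,
# the sesquilinear covariant Dirichlet form with its EXACT summation-by-parts identity, and the FIRST VARIATION at a constrained
# minimiser, for the charged scalar (U(1) background = King's model), every torus
# (`t4/skeletons/NE2-t4-ne2-p2.md` v0.5 §2.C / §7 supplier leaf s6; cell `pub-balaban`, NE2 formalisation swarm, leaf prover 09 gen 3)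

HONEST FRAMING (T4-DAG p. 1).  Rung (B)+1 only — NOT infinite volume, NOT a mass gap, NOT Clay.  Node NE2 (η-rate of the linear
theory) is NOT IN PRINT and NOT proved here.  MODEL LEVEL: bond phases `R` (data, no size assumption) and site transports `T` (data)
on the level-`n` torus `Tor (fine n M)` over the unit torus `Tor M`; lattice units; scalar (0-form) sector; ONE level (no tower, no
rate).  What is proved is OURS and elementary (finite-dimensional linear algebra + lattice bookkeeping); nothing printed is a
hypothesis; no `def … : Prop` fact; no `sorry`; axioms standard.  HONEST DEPENDENCY (cell, verbatim): continuum YM on T⁴ ⇐ BetaPertH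
∧ nine spine estimates (0/9 proved); BetaPertH ⇐ (D1) ∧ (D4) ∧ CAP+tail; G-an2-4 gates asym, D1 and NE2/3/4.

CONTENT.  Carriers of leaves P⁺/FED⁺ (`VariationalCovariantPoincare.QT`, `.dirR`, `VariationalCovariantFederbush.cD`): transported
block average `(Q_T f)(z) = n^{−d}Σ_j T(bpt z j)·f(bpt z j)` ([B9] (3.19) shape), covariant difference `(D_R f)(x,μ) = R(x,μ)f(x+e_μ) −
f(x)` ((3.3) shape), `dirR R f = Σ_{μ,x}|D_R f|²`.  New here:
 * §1 the covariant (negative) Laplacian `negLap R f = D_R† D_R f` and the sesquilinear form `dform R g f = Σ conj(D_R g)(D_R f)`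
   (`dform f f = dirR f`: `dirR_eq_dform`), with the EXACT covariant summation by parts on the torus
   `Σ_x conj(g x)·negLap R f x = dform R g f` (`inner_negLap`) — no curvature term, no boundary;
 * §2 FIRST VARIATION: `Q_T` is linear (`QT_add_smul`), `dirR (f + t•h) = dirR f + 2t·Re dform h f + t²·dirR h` (`dirR_add_smul`),
   hence if `f` minimises `dirR R` on the affine fibre `{g : Q_T g = μ}` then `dform R h f = 0` for every `h ∈ ker Q_T`
   (`dform_eq_zero_of_isMin`) — the Euler–Lagrange equation `⟨h, D_R†D_R f⟩ = 0` on `ker Q_T`.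
File 2/2 (`Support/VariationalCovariantRegularity`) draws the block structure of `D_R†D_R f` (the multiplier of leaf D, without KKT)
and the END `nsq (negLap R f) ≤ (Λ/n^d)·dirR R f` at a constrained minimiser by UB⁺-duality (leaf REG⁺, Laplacian form).
-/

noncomputable section

namespace Summit.QuantumFields.BalabanUV.T4Continuum.VariationalCovariantDirichletForm


open Finset
open scoped ComplexConjugate
open Literature.MathematicalPhysics.QuantumFieldTheory.Balaban1983to89
open Literature.MathematicalPhysics.QuantumFieldTheory.Balaban1983to89.B5Prop11Plancherel (Tor fine unitVec)
open Literature.MathematicalPhysics.QuantumFieldTheory.Balaban1983to89.B5Prop11Lower (nsq nsq_nonneg)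
open Literature.MathematicalPhysics.QuantumFieldTheory.Balaban1983to89.B5Block118 (bpt)
open Literature.MathematicalPhysics.QuantumFieldTheory.Balaban1983to89.B5Blocks16 (bpt_injective blockOf blockOf_bpt)
open Literature.MathematicalPhysics.QuantumFieldTheory.Balaban1983to89.B5AverageCurlStokes (sum_blocks_real)
open Summit.QuantumFields.BalabanUV.T4Continuum.VariationalCovariantFederbush (cD)
open Summit.QuantumFields.BalabanUV.T4Continuum.VariationalCovariantPoincare (QT dirR)

variable {d : ℕ}

/-! ## §1 The covariant Laplacian `D_R† D_R` and the sesquilinear Dirichlet form; exact summation by parts -/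

section General

variable (N : Fin d → ℕ) [∀ μ, NeZero (N μ)]

/-- the covariant (negative) Laplacian `(D_R† D_R f)(x) = Σ_μ [ conj R(x−e_μ,μ)·(D_R f)(x−e_μ,μ) − (D_R f)(x,μ) ]`
(for unit-modulus phases: `Σ_μ [2f(x) − R(x,μ)f(x+e_μ) − conj R(x−e_μ,μ) f(x−e_μ)]`). [folklore] -/
def negLap (R : Tor N → Fin d → ℂ) (f : Tor N → ℂ) (x : Tor N) : ℂ :=
  ∑ μ, (conj (R (x - unitVec N μ) μ) * cD N R f (x - unitVec N μ) μ - cD N R f x μ)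

/-- the sesquilinear covariant Dirichlet form `Σ_{μ,x} conj(D_R g)(D_R f)`. [folklore] -/
def dform (R : Tor N → Fin d → ℂ) (g f : Tor N → ℂ) : ℂ := ∑ μ, ∑ x, conj (cD N R g x μ) * cD N R f x μ

omit [∀ μ, NeZero (N μ)] in
/-- `D_R` is additive in the field. [folklore] -/
theorem cD_add (R : Tor N → Fin d → ℂ) (f g : Tor N → ℂ) (x : Tor N) (μ : Fin d) :
    cD N R (f + g) x μ = cD N R f x μ + cD N R g x μ := by
  simp only [cD, Pi.add_apply]; ring

omit [∀ μ, NeZero (N μ)] in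
/-- `D_R` is homogeneous in the field. [folklore] -/
theorem cD_smul (R : Tor N → Fin d → ℂ) (c : ℂ) (f : Tor N → ℂ) (x : Tor N) (μ : Fin d) :
    cD N R (c • f) x μ = c * cD N R f x μ := by
  simp only [cD, Pi.smul_apply, smul_eq_mul]; ring

/-- Hermitian symmetry of the form. [folklore] -/
theorem conj_dform (R : Tor N → Fin d → ℂ) (g f : Tor N → ℂ) : conj (dform N R g f) = dform N R f g := by
  unfold dform
  rw [map_sum]
  refine sum_congr rfl fun μ _ => ?_
  rw [map_sum]
  refine sum_congr rfl fun x _ => ?_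
  rw [map_mul, starRingEnd_self_apply, mul_comm]

/-- the diagonal of the form is the Dirichlet sum: `dform f f = Σ_{μ,x}|D_R f|²`. [folklore] -/
theorem dform_self (R : Tor N → Fin d → ℂ) (f : Tor N → ℂ) :
    dform N R f f = ((∑ μ, ∑ x, ‖cD N R f x μ‖ ^ 2 : ℝ) : ℂ) := by
  unfold dform
  push_cast
  refine sum_congr rfl fun μ _ => sum_congr rfl fun x _ => ?_
  rw [Complex.conj_mul']

/-- additivity of the form in the second slot. [folklore] -/
theorem dform_add_right (R : Tor N → Fin d → ℂ) (g f₁ f₂ : Tor N → ℂ) :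
    dform N R g (f₁ + f₂) = dform N R g f₁ + dform N R g f₂ := by
  unfold dform
  rw [← sum_add_distrib]
  refine sum_congr rfl fun μ _ => ?_
  rw [← sum_add_distrib]
  refine sum_congr rfl fun x _ => ?_
  rw [cD_add]; ring

/-- additivity of the form in the first slot. [folklore] -/
theorem dform_add_left (R : Tor N → Fin d → ℂ) (g₁ g₂ f : Tor N → ℂ) :
    dform N R (g₁ + g₂) f = dform N R g₁ f + dform N R g₂ f := by
  unfold dform
  rw [← sum_add_distrib]
  refine sum_congr rfl fun μ _ => ?_
  rw [← sum_add_distrib]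
  refine sum_congr rfl fun x _ => ?_
  rw [cD_add, map_add]; ring

/-- conjugate-homogeneity of the form in the first slot. [folklore] -/
theorem dform_smul_left (R : Tor N → Fin d → ℂ) (c : ℂ) (g f : Tor N → ℂ) :
    dform N R (c • g) f = conj c * dform N R g f := by
  unfold dform
  rw [mul_sum]
  refine sum_congr rfl fun μ _ => ?_
  rw [mul_sum]
  refine sum_congr rfl fun x _ => ?_
  rw [cD_smul, map_mul]; ring

/-- homogeneity of the form in the second slot. [folklore] -/
theorem dform_smul_right (R : Tor N → Fin d → ℂ) (c : ℂ) (g f : Tor N → ℂ) :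
    dform N R g (c • f) = c * dform N R g f := by
  unfold dform
  rw [mul_sum]
  refine sum_congr rfl fun μ _ => ?_
  rw [mul_sum]
  refine sum_congr rfl fun x _ => ?_
  rw [cD_smul]; ring

/-- **EXACT COVARIANT SUMMATION BY PARTS** on the torus: `Σ_x conj(g x)·(D_R†D_R f)(x) = Σ_{μ,x} conj(D_R g)(D_R f)` — no curvature term,
no boundary. [folklore] -/
theorem inner_negLap (R : Tor N → Fin d → ℂ) (g f : Tor N → ℂ) :
    ∑ x, conj (g x) * negLap N R f x = dform N R g f := by
  unfold negLap dform
  simp_rw [mul_sum, mul_sub]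
  rw [sum_comm]
  refine sum_congr rfl fun μ _ => ?_
  rw [sum_sub_distrib]
  have htr : ∑ x, conj (g x) * (conj (R (x - unitVec N μ) μ) * cD N R f (x - unitVec N μ) μ)
      = ∑ x, conj (g (x + unitVec N μ)) * (conj (R x μ) * cD N R f x μ) := by
    rw [← Equiv.sum_comp (Equiv.addRight (unitVec N μ))]
    refine sum_congr rfl fun x _ => ?_
    simp [add_sub_cancel_right]
  rw [htr, ← sum_sub_distrib]
  refine sum_congr rfl fun x _ => ?_
  simp only [cD, map_sub, map_mul]
  ring

end General

/-! ## §2 First variation at a constrained minimiser -/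

section Variation

variable (n : ℕ) [NeZero n] (M : Fin d → ℕ) [hM : ∀ μ, NeZero (M μ)]

omit [NeZero n] hM in
/-- `Q_T` is additive-homogeneous: `Q_T (f + c•h) = Q_T f + c•Q_T h`. [folklore] -/
theorem QT_add_smul (T f h : Tor (fine n M) → ℂ) (c : ℂ) :
    QT n M T (f + c • h) = QT n M T f + c • QT n M T h := by
  funext z
  simp only [QT, Pi.add_apply, Pi.smul_apply, smul_eq_mul]
  rw [mul_left_comm c, ← mul_add]
  congr 1
  rw [Finset.mul_sum, ← Finset.sum_add_distrib]
  exact sum_congr rfl fun j _ => by ring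

omit [NeZero n] hM in
/-- `Q_T 0 = 0`. [folklore] -/
theorem QT_zero (T : Tor (fine n M) → ℂ) : QT n M T 0 = 0 := by
  funext z
  simp [QT]

/-- `dirR` is the diagonal of `dform` on the torus `fine n M`. [folklore] -/
theorem dirR_eq_dform (R : Tor (fine n M) → Fin d → ℂ) (f : Tor (fine n M) → ℂ) :
    ((dirR n M R f : ℝ) : ℂ) = dform (fine n M) R f f := by
  rw [dform_self]; rfl

/-- expansion of the Dirichlet sum along a real line: `dirR (f + t•h) = dirR f + 2t·Re dform h f + t²·dirR h`. [folklore] -/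
theorem dirR_add_smul (R : Tor (fine n M) → Fin d → ℂ) (f h : Tor (fine n M) → ℂ) (t : ℝ) :
    dirR n M R (f + (t : ℂ) • h) = dirR n M R f + 2 * t * (dform (fine n M) R h f).re + t ^ 2 * dirR n M R h := by
  set w : ℂ := dform (fine n M) R h f with hw
  have hfh : dform (fine n M) R f h = conj w := by rw [hw, conj_dform]
  have e : ((dirR n M R (f + (t : ℂ) • h) : ℝ) : ℂ)
      = ((dirR n M R f : ℝ) : ℂ) + (t : ℂ) * conj w + (t : ℂ) * w + (t : ℂ) * ((t : ℂ) * ((dirR n M R h : ℝ) : ℂ)) := by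
    rw [dirR_eq_dform, dform_add_left, dform_add_right, dform_smul_right, dform_smul_left, Complex.conj_ofReal,
      dform_add_right, dform_smul_right, ← dirR_eq_dform, ← dirR_eq_dform, hfh, ← hw]
    ring
  have hre : (t : ℂ) * conj w + (t : ℂ) * w = ((2 * t * w.re : ℝ) : ℂ) := by
    rw [← mul_add, add_comm, Complex.add_conj]; push_cast; ring
  rw [add_assoc (((dirR n M R f : ℝ) : ℂ)), hre] at e
  have e' : ((dirR n M R (f + (t : ℂ) • h) : ℝ) : ℂ) = ((dirR n M R f + 2 * t * w.re + t ^ 2 * dirR n M R h : ℝ) : ℂ) := by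
    rw [e]; push_cast; ring
  exact Complex.ofReal_injective e'

/-- **FIRST VARIATION**: if `f` minimises `dirR R` on the affine fibre `{g : Q_T g = μ}` then the form vanishes against the kernel of
`Q_T`: `dform R h f = 0` whenever `Q_T h = 0`. [folklore] -/
theorem dform_eq_zero_of_isMin (T : Tor (fine n M) → ℂ) (R : Tor (fine n M) → Fin d → ℂ) {μ : Tor M → ℂ}
    {f : Tor (fine n M) → ℂ} (hf : QT n M T f = μ) (hmin : ∀ g, QT n M T g = μ → dirR n M R f ≤ dirR n M R g)
    {h : Tor (fine n M) → ℂ} (hh : QT n M T h = 0) : dform (fine n M) R h f = 0 := by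
  -- real part, for any kernel element
  have hre : ∀ h' : Tor (fine n M) → ℂ, QT n M T h' = 0 → (dform (fine n M) R h' f).re = 0 := by
    intro h' hh'
    -- `0 ≤ 2tb + t²c` for all real `t` (with `c = dirR h' ≥ 0`) forces `b = 0`: evaluate at `t = −b/(c+1)`
    set b : ℝ := (dform (fine n M) R h' f).re
    set c : ℝ := dirR n M R h'
    have hc : 0 ≤ c := by unfold c dirR; positivity
    have hq : ∀ t : ℝ, 0 ≤ 2 * t * b + t ^ 2 * c := fun t => by
      have hfib : QT n M T (f + (t : ℂ) • h') = μ := by rw [QT_add_smul, hh', smul_zero, add_zero, hf]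
      have := hmin _ hfib
      rw [dirR_add_smul] at this
      linarith
    have hc1 : 0 < c + 1 := by linarith
    have h1 := hq (-b / (c + 1))
    have e : 2 * (-b / (c + 1)) * b + (-b / (c + 1)) ^ 2 * c = -(b ^ 2 * (c + 2)) / (c + 1) ^ 2 := by
      field_simp; ring
    rw [e] at h1
    have h2 : b ^ 2 * (c + 2) ≤ 0 := by
      have := mul_nonneg h1 (le_of_lt (pow_pos hc1 2))
      rw [div_mul_cancel₀ _ (ne_of_gt (pow_pos hc1 2))] at this
      linarith
    nlinarith [sq_nonneg b]
  have h1 := hre h hh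
  have h2 := hre (Complex.I • h) (by
    have := QT_add_smul n M T 0 h Complex.I
    rw [zero_add, hh, smul_zero, add_zero, QT_zero] at this
    exact this)
  rw [dform_smul_left, Complex.conj_I] at h2
  have him : (dform (fine n M) R h f).im = 0 := by
    have : (-Complex.I * dform (fine n M) R h f).re = (dform (fine n M) R h f).im := by
      simp [Complex.mul_re]
    rw [← this]; exact h2
  exact Complex.ext h1 him

end Variation

end Summit.QuantumFields.BalabanUV.T4Continuum.VariationalCovariantDirichletForm

end
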